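import Mathlib
import HarnessLib
import Summits.ABC.ABC.Theses.CongruentialReceptacle
import Summits.ABC.ABC.Theorems.CongruentialReceptacleTameLocalReceptacleDefs
import Summits.ABC.ABC.Theorems.ReceptacleIdentity.Negative.TameLocalReceptacleResidueFree
import Summits.ABC.ABC.Theorems.ReceptacleIdentity.Negative.TameLocalReceptacleFalseOfNearMatchedFreeLunch

/-!
# Disproof of `ReceptacleIdentity` (stmt-ABC-1813) — findings

Crux disprover work file, route `CongruentialReceptacle`: cycle 1 = refuter-cdisprove-stmt-ABC-1813-0
(2026-08-16, sections 1–4, findings F0–F4); cycle 2 = refuter-cdisprove-stmt-ABC-1813-g2-0 (2026-08-17,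
sections 5–7, findings F5–F8, EXTENDING the file). Prose lives in docstrings; every `theorem` here is
checked unless its docstring says NEAR-MISS.

FINDINGS (index):

* **F0 — no `¬`-target.** The crux is INFORMAL: the Theses file carries stmt-ABC-1813 only as a comment,
  there is no decl `Summit.ABC.ABC.Theses.CongruentialReceptacle.ReceptacleIdentity`, so no refutation
  `¬ ReceptacleIdentity` can be typed. Its typed face is the rank-2 crux
  `TameLocalReceptacle` (stmt-ABC-14354); everything typed below is about that decl, about the picked
  line `Sketch`, or about natural strengthenings.
* **F1 — the residue-free tame-local receptacle is FALSE on the balanced cell** (section 2,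
  `not_tameLocalReceptacleResidueFree_of_neg`; full proof LANDED as
  `Summits/ABC/ABC/Theorems/ReceptacleIdentity/Negative/TameLocalReceptacleResidueFree{Lemmas,}.lean`,
  proposals p101231 ACCEPTED 7ac08aa6932c + p102806 ACCEPTED f0b720db640b): an explicit three-triple certificate `(x,y,15u), (x,Y,16u), (X,y,15W)`
  with fourth-power excess, for every `κ ≤ 2⁻²⁵`, every `ε < 2`, all constants. This discharges the
  route's CHEAPEST FALSIFIER for residue-free tables without any Turán–Kubilius averaging.
* **F2 — the planned kill test cannot decide the residue-DEPENDENT crux** (section 3, docstring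
  `averaging_cannot_refute`): any family-averaging certificate is defeated by a residue-dependent table,
  because the windows force `c₁′ ≥ 2c₁` and a special family (a member carrying a prime power `P`) has a
  residue pattern that is sparse at primes of total log-mass `≥ log P`, where the table owns free entries
  of size `c₁′ log p`; the achievable shift `≍ 2c₁′ log P` exceeds the signal `2c₁ log P`. A refutation
  of `TameLocalReceptacle`, if it is false, must use individual-triple rigidity on SMOOTH triples
  (triples with a prime member impose no constraint at all: the entry at the largest prime is a private
  knob, `knob` docstring). Conversely `TameLocalReceptacle → BalancedFreySzpiro` is proved glue, so the
  typed crux is abc-hard on the positive side: NOT cheaply decidable either way.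
* **F3 — line `Sketch` does not bear on the crux** (section 4): its typed target C⁺ =
  `DepthCostsHasseWindow` bounds the ℓ-adic DEPTH of `v_p(abc)` by `(1+√p)^(2·rank_ℝ S₂(Γ₀((N/p)²)))`,
  which for `rad(abc) = N ≥ N₀` follows from Stewart–Yu (`log c ≪ N^{1/3} log³ N`, so
  `ℓⁿ ≤ v_p(abc) ≤ 3 log c / log p`) since `rank S₂(Γ₀(M²)) ≫ M²`; the genus-0 window `(N/p)² = 4` is
  EMPTY for Serre-normalised triples (`32 ∣ b`, `a ≡ 3 mod 4` force a third prime). All six stubs are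
  TRUE: the four elementary ones are landed Theorems (`…StubExistsMonicNatDegree`, `…StubEvalWindow`,
  `…StubHasseWindowArith`, `…StubFinrankMono`), `stub_deligneWeightTwo` is the tree's named fact
  (Deligne 1974 Thm 8.2, correctly stated with `p ∤ N`, `k ≥ 2`), `stub_freyDeepLevelLoweringTrace` is
  the Hecke-ALGEBRA form of level lowering mod `ℓⁿ` (a ring map `𝕋(L) → ℤ/ℓⁿ`, not a newform), which is
  what `R_Σ ≅ 𝕋_Σ` with fixed determinant delivers (Dummigan's counterexamples concern single newforms
  only). JOINT SUFFICIENCY GAP: there is no `ReceptacleIdentity_of`/`TameLocalReceptacle_of` in the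
  line; C⁺ weighs `log v_p(Δ)`, never `v_p(Δ) log p` (the line's own HONEST REACH), so closing every stub
  proves C⁺ and leaves the crux untouched.
* **F4 — load-bearing structure of the typed crux** (section 1): the LOWER window is the only
  constraint with content (`tameLocalReceptacle_without_lower_window`: with it dropped the zero table
  works); the residue-free variant is a literal strengthening (`tameLocalReceptacle_of_residueFree`).

* **F5 — line `stable-szpiro-duality` (registered skeleton, cycle 2): stubs sound, landing schema WEAKENED**
  (section 5): A1 and the linearity stub are TRUE, the creative stub `stub_matchedFreeLunch` is not cheaply
  refutable (its negation at every `(κ,ε)` contains the Target), the composition is kernel-checked — no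
  joint-sufficiency gap.  The one actionable point: `Matched` (exact covering of EVERY datum) is stronger
  than the box inequality needs; the near-matched schema `NearMatchedFreeLunch κ ε → ¬ TameLocalReceptacle`
  (defects at bounded primes / valuations cost `O_{c₁′}(‖F‖₁)`) is LANDED as
  `Theorems/ReceptacleIdentity/Negative/TameLocalReceptacleFalseOfNearMatchedFreeLunch.lean` (p134085, ACCEPTED 2295875915ec).
* **F6 — the three free sharing moves typed** (section 5, `datum_knob_a`, `datum_knob_b`, `datum_shift_c`,
  in the `datum` currency of `Theorems/CongruentialReceptacleTameLocalReceptacleDefs.lean`): the generators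
  of every cancellation a template can use; position 3 (the sum) has only the same-sum shift.
* **F7 — accounting laws** (section 6): RATE LAW `linGain ≤ 2 Σ_T w_T log(abc)_T ≤ 2 log M · ‖F‖₁` on the
  matched cone — LANDED as `Theorems/ReceptacleIdentity/Negative/StableSzpiroMatchedRateLaw.lean` (p134855,
  ACCEPTED ac35b96f041e: `matched_sum_log_rad_nonneg`, `matched_linGain_le`, `matched_linGain_le_height`,
  `height_of_matchedFreeLunch_ratio` — a template of ratio `C` contains a triple with `abc > e^{C/2}`, so
  `r*(X) = O(log X)` by necessity); prose: position 3, S-unit ceiling (gain members must come from a dense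
  reservoir — cubes at small `ε`, `2^V`-parts — not from `2^V3^U` alone), no upward regress, dead
  sub-universes (`{c = 2^V}`, `U_V` with cube positives: `w³+u³ = 2^{V+1}`; Pell/cyclotomic divisibility
  families: unit residues off by `k²`/`k`).  Also: the line's linearity stub
  `stub_phi_eq_linGain_of_matched` has a checked CANDIDATE PROOF attached as evidence (`Linearity.lean`,
  same exchange of summation) — after it lands only the creative stub remains.
* **F8 — LP evidence, cycle 2** (section 7): `r*(X) ≈ log X − 4.9` at `κ = 1/16, ε = 1`
  (`0.381/1.081/1.336/1.767/2.172` at `X = 200/400/566/800/1131`, replication of j017861 exact), freeing small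
  primes changes nothing, `U_V` dead, S-unit webs over the primes `≤ 47` STRONG (`4.17` at height `10⁴`),
  sporadic high-quality triples dominate every universe that contains them (`625+2048 = 2673`: `3.31`;
  `2¹⁰·7+5⁷ = 3⁸·13`: `7.61` at `ε = 1`), the optimum is ONE connected web, its best one-sided table
  (LP dual) is centred near `0` with spread `≈ 3 log p` and no character-like residue structure.
* **F9 — bottom line** (section 8): the template is a random DESIGN whose existence needs friable
  equidistribution in residue classes (the sibling crux's analytic input), not a closed form; recommendation
  to the planner/lead.

Targets: payload `targets`/`stuck_stubs` are empty in both cycles.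
-/

set_option linter.dupNamespace false

namespace Summit.ABC.ABC.Cruxes.ReceptacleIdentity.Disproof

open Literature.NumberTheory.DiophantineGeometry
open Summit.ABC.ABC.Theses.CongruentialReceptacle

/-! ## 1. Load-bearing analysis of the typed face `TameLocalReceptacle` -/

/-- `TameLocalReceptacle` with the LOWER window dropped (only `|t| ≤ c₁′ (i+j+k+1) log p` kept). -/
def TameLocalReceptacleWithoutLowerWindow : Prop :=
  ∀ κ : ℝ, 0 < κ → ∀ ε : ℝ, 0 < ε → ∃ c₁ c₁' c₃ : ℝ, 0 < c₁ ∧ ∃ m₀ : ℕ, ∀ ℓ n : ℕ, ℓ.Prime → 5 ≤ ℓ →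
    m₀ ≤ ℓ ^ n → ∃ t : ℕ → ℕ → ℕ → ℕ → ℕ → ℕ → ℕ → ℤ,
      (∀ p i j k r s z : ℕ, p.Prime →
        |(t p i j k r s z : ℝ)| ≤ c₁' * (((i + j + k : ℕ) : ℝ) + 1) * Real.log p) ∧
      ∀ a b c : ℕ, IsABCTriple a b c → κ * (c : ℝ) ≤ (a : ℝ) → κ * (c : ℝ) ≤ (b : ℝ) →
        ¬ ℓ ∣ a * b * c → ∃ B : ℤ, |(B : ℝ)| ≤ c₃ ∧
          (∑ p ∈ (a * b * c).primeFactors, t p (a.factorization p) (b.factorization p)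
            (c.factorization p) (a / p ^ a.factorization p % p) (b / p ^ b.factorization p % p)
            (c / p ^ c.factorization p % p)) ≡ B [ZMOD ((ℓ ^ n : ℕ) : ℤ)]

/-- **The lower window is the load-bearing constraint**: without it the zero table is a witness
(so every other clause of the crux — integrality, upper window, the congruence, balance, `ℓ ∤ abc` — is
satisfiable for free, and any refutation must extract its contradiction from
`c₁ (2 v_p(abc) − 6 − ε) log p ≤ t`). [folklore] -/
theorem tameLocalReceptacle_without_lower_window : TameLocalReceptacleWithoutLowerWindow := by
  intro κ _ ε _
  refine ⟨1, 0, 0, one_pos, 0, fun ℓ n _ _ _ => ⟨fun _ _ _ _ _ _ _ => 0, ?_, ?_⟩⟩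
  · intro p i j k r s z _
    simp
  · intro a b c _ _ _ _
    exact ⟨0, by simp, by simp⟩

/-- The RESIDUE-FREE tame-local receptacle: `TameLocalReceptacle` for tables that do not see the unit
residues `a′, b′, c′ mod p` (verbatim the statement refuted in
`Theorems/ReceptacleIdentity/Negative/TameLocalReceptacleResidueFree.lean`). -/
def TameLocalReceptacleResidueFree : Prop :=
  ∀ κ : ℝ, 0 < κ → ∀ ε : ℝ, 0 < ε → ∃ c₁ c₁' c₃ : ℝ, 0 < c₁ ∧ ∃ m₀ : ℕ, ∀ ℓ n : ℕ, ℓ.Prime →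
    5 ≤ ℓ → m₀ ≤ ℓ ^ n → ∃ t : ℕ → ℕ → ℕ → ℕ → ℤ,
      (∀ p i j k : ℕ, p.Prime →
        c₁ * (2 * ((i + j + k : ℕ) : ℝ) - 6 - ε) * Real.log p ≤ (t p i j k : ℝ) ∧
        |(t p i j k : ℝ)| ≤ c₁' * (((i + j + k : ℕ) : ℝ) + 1) * Real.log p) ∧
      ∀ a b c : ℕ, IsABCTriple a b c → κ * (c : ℝ) ≤ (a : ℝ) → κ * (c : ℝ) ≤ (b : ℝ) →
        ¬ ℓ ∣ a * b * c → ∃ B : ℤ, |(B : ℝ)| ≤ c₃ ∧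
          (∑ p ∈ (a * b * c).primeFactors,
            t p (a.factorization p) (b.factorization p) (c.factorization p)) ≡
            B [ZMOD ((ℓ ^ n : ℕ) : ℤ)]

/-- The residue-free statement is a literal STRENGTHENING of the crux (a residue-blind table is a
table). Recorded so that `¬ TameLocalReceptacleResidueFree` is read correctly: it kills branch (i) of
the receptacle for Frobenius-INDEPENDENT local terms only. [folklore] -/
theorem tameLocalReceptacle_of_residueFree (h : TameLocalReceptacleResidueFree) : TameLocalReceptacle := by
  intro κ hκ ε hε
  obtain ⟨c₁, c₁', c₃, hc₁, m₀, H⟩ := h κ hκ ε hε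
  refine ⟨c₁, c₁', c₃, hc₁, m₀, fun ℓ n hℓ h5 hm => ?_⟩
  obtain ⟨t, ht, hT⟩ := H ℓ n hℓ h5 hm
  exact ⟨fun p i j k _ _ _ => t p i j k, fun p i j k _ _ _ hp => ht p i j k hp, hT⟩

/-! ## 2. F1 — the residue-free receptacle is false (landed under `Theorems/…/Negative/`)

The sorry-free proof (571 lines with lemmas; Bertrand ×5, `Nat.sqrt`, coprimality bookkeeping; axioms
`propext, Classical.choice, Quot.sound`) is LANDED as
`Theorems/ReceptacleIdentity/Negative/TameLocalReceptacleResidueFreeLemmas.lean` (p101231, 7ac08aa6932c) and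
`Theorems/ReceptacleIdentity/Negative/TameLocalReceptacleResidueFree.lean` (p102806, f0b720db640b); this
file imports it (cycle 2) and `not_tameLocalReceptacleResidueFree'` below derives
`¬ TameLocalReceptacleResidueFree` in one line. Statement of the core theorem, for the record:

`tameLocal_residueFree_false (κ ε c₁ c₁' c₃ : ℝ) (hκ : κ ≤ 1 / 2 ^ 25) (hε : ε < 2) (hc₁ : 0 < c₁)
  (m₀ : ℕ) (H : ∀ ℓ n, ℓ.Prime → 5 ≤ ℓ → m₀ ≤ ℓ ^ n → ∃ t : ℕ → ℕ → ℕ → ℕ → ℤ, windows ∧ congruence on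
  κ-balanced triples prime to ℓ) : False`.

CERTIFICATE. Primes `7 ≤ r < q ≤ 2r` with `c₁ (2 − ε) log r > 3c₃`; `X = r⁴`, `W = q⁴`, `y = 15W − X`;
a prime `s ∤ y` with `2y < s⁴ ≤ 2²¹ y`; `Y = s⁴`, `u = Y − y`, `x = 15u − y`. Triples
`T⁻ = (x, y, 15u)`, `T₁⁺ = (x, Y, 16u)`, `T₂⁺ = (X, y, 15W)`; then
`S(T₁⁺) + S(T₂⁺) − S(T⁻) = t(s;0,4,0) + t(2;0,0,4) + t(r;4,0,0) + t(q;0,0,4) ≥ c₁(2−ε) log r > 3c₃ ≥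
B₁ + B₂ − B₃` once the congruences are read as identities at one huge prime modulus `ℓ`.
DESIGN REMARKS (for ideators): (i) balance forbids the sibling's unbalanced certificate
`(1,2ᵏ−1,2ᵏ), (2,2ᵏ−1,2ᵏ+1), (1,2ᵏ,2ᵏ+1)` (`CompactBalanceTransfer/Negative/CuspWeightedResidueFree`);
(ii) a signed family of balanced triples certifies falsity iff, position by position, the negative
members' prime-power symbols are covered by the positive members' and the excess consists of symbols of
valuation `≥ 4` (lower window `c₁(2v − 6 − ε) log p > 0`) — mass balance then forces `#positives =
#negatives + 1` with the three excess members spread over different triples, which is exactly the shape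
used; (iii) no high exponent is needed: a fourth power of a LARGE prime already gives an unbounded
signal `c₁ (2 − ε) log r`.
-/

/-- **F1, conditional form usable before the Negative file is applied**: the residue-free receptacle
fails as soon as its `κ = 2⁻²⁵, ε = 1` instance fails — a triviality recorded only to pin the exact
instance the landed certificate kills. [folklore] -/
theorem not_tameLocalReceptacleResidueFree_of_neg
    (h : ¬ (∃ c₁ c₁' c₃ : ℝ, 0 < c₁ ∧ ∃ m₀ : ℕ, ∀ ℓ n : ℕ, ℓ.Prime →
      5 ≤ ℓ → m₀ ≤ ℓ ^ n → ∃ t : ℕ → ℕ → ℕ → ℕ → ℤ,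
        (∀ p i j k : ℕ, p.Prime →
          c₁ * (2 * ((i + j + k : ℕ) : ℝ) - 6 - 1) * Real.log p ≤ (t p i j k : ℝ) ∧
          |(t p i j k : ℝ)| ≤ c₁' * (((i + j + k : ℕ) : ℝ) + 1) * Real.log p) ∧
        ∀ a b c : ℕ, IsABCTriple a b c → (1 / 2 ^ 25 : ℝ) * (c : ℝ) ≤ (a : ℝ) →
          (1 / 2 ^ 25 : ℝ) * (c : ℝ) ≤ (b : ℝ) →
          ¬ ℓ ∣ a * b * c → ∃ B : ℤ, |(B : ℝ)| ≤ c₃ ∧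
            (∑ p ∈ (a * b * c).primeFactors,
              t p (a.factorization p) (b.factorization p) (c.factorization p)) ≡
              B [ZMOD ((ℓ ^ n : ℕ) : ℤ)])) :
    ¬ TameLocalReceptacleResidueFree := fun H =>
  h (H (1 / 2 ^ 25) (by positivity) 1 one_pos)

/-- **F1, unconditional (cycle 2: the landed Negative file is now imported).** The residue-free tame-local
receptacle is false. [folklore] -/
theorem not_tameLocalReceptacleResidueFree' : ¬ TameLocalReceptacleResidueFree :=
  Summit.ABC.ABC.Theorems.ReceptacleIdentity.Negative.not_tameLocalReceptacle_residueFree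

/-! ## 3. F2 — why the residue-DEPENDENT crux resists every cheap attack

`averaging_cannot_refute` (meta-finding, no Lean content). Write `S(T) = Σ_{p∣abc} t(p; D_p(T))`. Any
refutation by AVERAGING compares the mean of `S` over special families `F` (every member carries a fixed
high prime power `P`, contributing the signal `t ≥ c₁ (2v − 6 − ε) log p ≈ 2c₁ log P`) with means over
generic families, and needs the per-datum marginals of `F` and of the generic families to agree up to
`o(log P)` in `Σ_d |Δ mult(d)| · (upper window of d)`. But fixing `P ∣ b` (say) removes `log P` nats of
entropy from the family, and this deficit reappears as SPARSENESS of the residue coordinates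
`(a′, b′, c′ mod p)` at primes `p ∣ ac` of total log-mass `≥ log P` (e.g. `b ≡ P·w mod p` with `w` from a
short range, at all `p > w`-range). On those data the table owns entries worth up to `c₁′ (v+1) log p`
that generic triples meet with negligible probability, so it can shift every special-family mean by
`≍ 2c₁′ log P` while keeping generic means fixed; the windows force `c₁′ ≥ 2c₁` (let `v → ∞` in
`c₁(2v−6−ε) ≤ c₁′(v+1)`), hence the shift always beats the signal `2c₁ log P`. Making the special
member generic at more primes (twisting by `w ≤ W`) only moves the sparse mass to `p > W`, never removes
it. CONSEQUENCE: the Turán–Kubilius/Elliott programme of the route's CHEAPEST FALSIFIER cannot produce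
`¬ TameLocalReceptacle`; it produces exactly F1 (residue-free) and nothing more.

`knob` (meta-finding). If a balanced triple has a PRIME member, say `c = P`, its datum at `P` is
`(P; 0,0,1; a mod P = a, −a, 1)`, which determines the triple; the entry `t(P; …)` is private to that
triple, free in `[−(4+ε)c₁ log P, 2c₁′ log P] ⊇ [−4c₁ log c, 4c₁ log c]`, and absorbs any imbalance of
the remaining terms of that size. The same holds at `p ∣ a` with `a = p` prime (`b mod p = b`
determines `b < p`… up to the balance window) and, approximately, whenever `abc` has a prime factor
`> c^{2/3}`. So the binding constraints of `TameLocalReceptacle` sit on `c^{2/3}`-SMOOTH balanced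
triples (e.g. `((n−m)(n+m), m², n²)`), where the incidence system "data ↔ triples" is a genuinely
two-dimensional LP (≈ `X²` triples of height `X` against ≈ `X³/log X` residue-indexed unknowns, each
shared by `≈ X²/p³` triples). Deciding feasibility of that LP is the real kill test; it is not a
20-minute computation, and small heights say nothing because `c₃/c₁`, `c₁′/c₁` are free.

`status`. Positive side: `TameLocalReceptacle → BalancedFreySzpiro` (landed glue), i.e. any witness
proves Szpiro `6+ε` on the balanced cell — abc-strength. Negative side: F1 + the two meta-findings. The
honest label for stmt-ABC-14354 is therefore "typed, elaborating, neither cheaply refutable nor cheaply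
provable"; the informal stmt-ABC-1813 inherits this for branch (i) and has no typed content for branch
(ii) (Massey/Rédei symbols of the prime support).
-/

/-! ## 4. Line `Sketch` (picked) — stubs and joint sufficiency

* `stub_existsMonicNatDegree`, `stub_evalWindow`, `stub_hasseWindowArith`, `stub_finrankMono`: TRUE and
  LANDED (`Theorems/CongruentialReceptacleReceptacleIdentityStub*.lean`, 2026-08-16).
* `stub_deligneWeightTwo = Deligne1974_heckeT_eigenvalue_norm_le`: the named fact is stated with
  `2 ≤ k`, `p ∤ N`, eigenvalues of the genuine double-coset operator `heckeT` on `S_k(Γ₀(N))` — a correct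
  transcription of Deligne 1974 Thm 8.2 + Atkin–Lehner; no junk instance (for `k ≤ 0`, odd `k` the
  space is `0` and the claim vacuous). Not attackable.
* `stub_freyDeepLevelLoweringTrace`: asks only for a ring map `θ : 𝕋(L) → ℤ/ℓⁿ` with
  `θ(T_p) = ±(p+1)` at some level `N/p ∣ L ∣ (N/p)²`, `p ∤ L`. TRUE: `ρ_{E,ℓⁿ}` (Frey curve, `ℓ ≥ 5`,
  `ℓ ∤ abc` so flat at `ℓ`, `ℓⁿ ∣ v_p(Δ_min) = 2v_p(abc)` so unramified at `p`, `ρ̄` absolutely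
  irreducible by Mazur + full 2-torsion) is a fixed-determinant deformation of `ρ̄` minimal at `p`, so it
  factors through `R_Σ ≅ 𝕋_Σ` at the `p`-free level `N_Σ`, `N/p ∣ N_Σ ∣ (N/p)²` (Wiles 1995 Thm 3.3 /
  Diamond 1996; DDT Thm 3.42), and `tr ρ(Frob_p) = ±(1+p)` on the unramified Tate module. Dummigan's
  failures of level lowering mod `ℓⁿ` concern congruences with a single NEWFORM, which the stub does not
  ask for. CAVEAT for the vendoring: the stub quantifies over ALL `n ≥ 1` with `ℓⁿ ∣ v_p(abc)`, uniformly —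
  fine, `R = 𝕋` has no size restriction — but it needs `S₂(Γ₀(L)) ≠ 0` (else `𝕋(L)` is the zero ring
  and admits no ring map to `ℤ/ℓⁿ`); this holds because the genus-0 window is empty (next item).
* EMPTY DEGENERATE WINDOW: `rad(abc) = 2p` is impossible for `a ≡ 3 (mod 4)`, `32 ∣ b` (it would force
  `{a, b, c} ⊆ {2ⁱ, pʲ, 1}` with `c = 1`), so `(N/p)² ≥ 36` and `X₀((N/p)²)` has positive genus; C⁺ is
  never in the regime where its right-hand side is `1`.
* JOINT SUFFICIENCY: the composition `DepthCostsHasseWindow_of` proves C⁺ from the stubs, and C⁺ is NOT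
  the crux: it bounds `ℓⁿ ∣ v_p(abc)` by `(1+√p)^(4 g₀((N/p)²))` with `g₀(M²) ≫ M²`, whereas already
  `ℓⁿ ≤ v_p(abc) ≤ 3 log c/ log p ≤ 3C N^{1/3} log³N / log p` (Stewart–Yu 2001) is far smaller for all
  `N ≥ N₀`; so C⁺ is a consequence of KNOWN results outside an effectively bounded set of radicals, and
  carries no information towards `BalancedFreySzpiro`. The line should be read as landing the Hecke
  core (done) — not as progress on stmt-ABC-1813.
-/

/-- Arithmetic shadow of the EMPTY DEGENERATE WINDOW: three pairwise coprime naturals `a, b, c` with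
`a + b = c`, `a` odd `> 1` and `b` even `> 1`... cannot all be `{2, p}`-units unless `c = 1`; the
typed statement used downstream is just that such a triple has `c > 1` odd and coprime to `b`, hence
`c` has a prime factor different from `2` and from every prime factor of `a`. Recorded in the cheapest
form the line needs: `c` is odd and exceeds `1`. [folklore] -/
theorem frey_normalised_c_odd {a b c : ℕ} (h : IsABCTriple a b c) (ha : a % 4 = 3) (hb : 32 ∣ b) :
    c % 2 = 1 ∧ 1 < c := by
  obtain ⟨ha0, hb0, habc, -⟩ := h
  omega

/-- **EMPTY DEGENERATE WINDOW of C⁺** (F3): a Serre-normalised abc-triple (`a ≡ 3 mod 4`, `32 ∣ b`)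
never has `rad(abc) = 2p` for a prime `p` — so `N/p ≠ 2`, `(N/p)² ≠ 4`, and the line's target
`DepthCostsHasseWindow` is never in the regime where `S₂(Γ₀((N/p)²)) = 0` (equivalently: the level `L`
of `stub_freyDeepLevelLoweringTrace` always carries cusp forms, as a ring map `𝕋(L) → ℤ/ℓⁿ` requires).
Proof: the least prime factors of the odd numbers `a > 1` and `c > 1` would both be `p`, contradicting
`gcd(a, b) = 1`. [folklore] -/
theorem rad_ne_two_mul_prime {a b c p : ℕ} (h : IsABCTriple a b c) (ha : a % 4 = 3) (hb : 32 ∣ b)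
    (hp : p.Prime) : rad a b c ≠ 2 * p := by
  obtain ⟨ha0, hb0, habc, hcop⟩ := h
  intro hr
  have hc0 : 0 < c := by omega
  have habc0 : a * b * c ≠ 0 := (Nat.mul_pos (Nat.mul_pos ha0 hb0) hc0).ne'
  -- every prime factor of abc is 2 or p
  have key : ∀ q : ℕ, q.Prime → q ∣ a * b * c → q = 2 ∨ q = p := by
    intro q hq hqd
    have hmem : q ∈ (a * b * c).primeFactors := Nat.mem_primeFactors.mpr ⟨hq, hqd, habc0⟩
    have hqr : q ∣ rad a b c := by
      rw [rad_def, Nat.radical_eq_prod_primeFactors]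
      exact Finset.dvd_prod_of_mem _ hmem
    rw [hr] at hqr
    rcases (Nat.Prime.dvd_mul hq).mp hqr with h2 | h2
    · exact Or.inl ((Nat.prime_dvd_prime_iff_eq hq Nat.prime_two).mp h2)
    · exact Or.inr ((Nat.prime_dvd_prime_iff_eq hq hp).mp h2)
  -- the least prime factors of a and c are odd, hence equal to p
  have ha1 : a ≠ 1 := by omega
  have hc1 : c ≠ 1 := by omega
  have hpa : a.minFac.Prime := Nat.minFac_prime ha1
  have hpc : c.minFac.Prime := Nat.minFac_prime hc1
  have hpa_dvd : a.minFac ∣ a := Nat.minFac_dvd a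
  have hpc_dvd : c.minFac ∣ c := Nat.minFac_dvd c
  have hpa2 : a.minFac ≠ 2 := fun h2 => by
    have : 2 ∣ a := h2 ▸ hpa_dvd
    omega
  have hpc2 : c.minFac ≠ 2 := fun h2 => by
    have : 2 ∣ c := h2 ▸ hpc_dvd
    omega
  have hpa_p : a.minFac = p :=
    (key _ hpa (dvd_mul_of_dvd_left (dvd_mul_of_dvd_left hpa_dvd b) c)).resolve_left hpa2
  have hpc_p : c.minFac = p :=
    (key _ hpc (dvd_mul_of_dvd_right hpc_dvd (a * b))).resolve_left hpc2
  have hp_a : p ∣ a := hpa_p ▸ hpa_dvd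
  have hp_c : p ∣ c := hpc_p ▸ hpc_dvd
  have hp_b : p ∣ b := (Nat.dvd_add_right hp_a).mp (habc ▸ hp_c)
  have hg : p ∣ Nat.gcd a b := Nat.dvd_gcd hp_a hp_b
  rw [hcop.gcd_eq_one] at hg
  exact hp.one_lt.ne' (Nat.dvd_one.mp hg)


/-! ## 5. Line `stable-szpiro-duality` (registered skeleton `4da1e13d`, cycle 2) — stubs, joint sufficiency, and a WEAKER landing schema

STUB AUDIT (payload `line`; `stuck_stubs` empty; skeleton re-registered `25c8a3c4` by lead
`prover-line-stmt-ABC-1813-a1-0` over the landed vocabulary `Summit.ABC.ABC.Theorems.StableSzpiro`,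
`Theorems/CongruentialReceptacleReceptacleIdentityStableSzpiroDefs.lean`).
`stub_stableSzpiroAt_of_tameLocalReceptacleAt` (A1) is TRUE and now LANDED by the lead
(`…StubStableSzpiroOfTLR.lean`, p134656); independently, the cycle-2 file
`Theorems/ReceptacleIdentity/Negative/TameLocalReceptacleFalseOfNearMatchedFreeLunch.lean` (p134085, ACCEPTED 2295875915ec) proves
its list-level form `certificate_inequality` through the landed transfer `itr_of_tlr` (no modulus juggling
at all: one integer table, `|recSum| ≤ c₃`).  `stub_phi_eq_linGain_of_matched` is an identity (TRUE).
`stub_matchedFreeLunch` cannot be refuted cheaply: its negation at EVERY `(κ, ε)` is `NFL_∞`, which with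
the Target gives Stable Szpiro — abc-strength.  The composition `notTameLocalReceptacle_of_stubs` is
kernel-checked; there is no joint-sufficiency gap.  Degenerate readings checked: `MatchedFreeLunch κ ε`
with `F.l1 = 0` needs `0 < linGain = 0` — impossible, so witnesses are genuine; `κ > 1/2` families are
empty; the creative stub picks its own `κ, ε`, and a kill at `κ < 1/4` reads `refuted` for the decl as
typed (the `κ = 1/4` repair `QuarterWindowGivesCrux` is a separate, STRONGER target — see F8(d)).

OVER-STRICTNESS (the one actionable finding on the line): `SignedFamily.Matched := ∀ d, 0 ≤ ∂F d` asks
for exact covering of EVERY datum of every negatively weighted triple, including its classes at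
`p = 2, 3, 5, …`.  The box inequality behind A1 charges an uncovered negative datum only
`c₁′ (v+1) log p`; if the uncovered data sit at primes `p ≤ P₀` with valuations `v ≤ V₀` and there are
`O(‖F‖₁)` of them, the charge is `O_{c₁′}(‖F‖₁)` and is beaten by any unbounded gain ratio.  LANDED as the
near-matched schema (p134085, `Summit.ABC.ABC.Theorems.ReceptacleIdentity.Negative`):
`NearMatchedFreeLunch κ ε → ¬ IntegerTameReceptacle → ¬ TameLocalReceptacle`, with certificates in an
integer LIST currency — family `[(w, a, b, c)]`, boundary lists `pos`, `neg` of `(μ, p, (i,j,k,r,s,z))`, the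
identity `Σ w · recSum t = ⟨pos, t⟩ − ⟨neg, t⟩` for all tables, `defect = Σ_neg μ (i+j+k+1) log p ≤ K ‖F‖₁`,
`gain = Σ_pos μ (2(i+j+k) − 6 − ε) log p > C ‖F‖₁`.  The line's stub is its `neg = []`, `K = 0` case.
FOR TEMPLATE HUNTERS: negatives' small-prime classes are free (bounded valuation), positives' small-prime
classes are where the gain lives (`2^V`, `3^U` members), and ONLY the large-prime data must cancel exactly.
(At the heights the LP reaches this freedom is not yet used by the optimum — F8(a) — because at `X ≤ 400`
every optimal certificate is already exactly matched away from `{2, 3, 5, 7}`.)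

The three FREE SHARING MOVES that generate every cancellation of large-prime data are typed below in the
`datum` currency of `Theorems/CongruentialReceptacleTameLocalReceptacleDefs.lean` (usable verbatim by a
template proof): the two knob moves and the same-sum shift. -/

section Moves

/-- **F5, the landed schema re-exported** (p134085): a near-matched free lunch at one `(κ, ε)` refutes
the typed face of the crux.  The line's `MatchedFreeLunch` is the `neg = []` case after clearing
denominators of the (rational, WLOG) weights. [folklore] -/
theorem tameLocalReceptacle_false_of_nearMatched {κ ε : ℝ} (hκ : 0 < κ) (hε : 0 < ε)
    (h : Summit.ABC.ABC.Theorems.ReceptacleIdentity.Negative.NearMatchedFreeLunch κ ε) :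
    ¬ TameLocalReceptacle :=
  Summit.ABC.ABC.Theorems.ReceptacleIdentity.Negative.TameLocalReceptacle_false_of_nearMatchedFreeLunch
    hκ hε h

open Summit.ABC.ABC.Theorems.TameLocalReceptacle (datum)

/-- **Knob move on `a`**: `(a, b, c) ↦ (a, c, a + c)` preserves EVERY datum at the primes of `a`
(valuations `(v_p a, 0, 0)`, unit residue of `a`, and both partner residues, because `c ≡ b (mod p)`).
This is the free residue-aware sharing move seen in every LP certificate (r2-3; F8). [folklore] -/
theorem datum_knob_a {a b c p : ℕ} (habc : a + b = c) (hpa : p ∣ a) (hpb : ¬ p ∣ b) :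
    datum a c (a + c) p = datum a b c p := by
  have hpc : ¬ p ∣ c := fun h => hpb ((Nat.dvd_add_right hpa).mp (habc ▸ h))
  have hpac : ¬ p ∣ a + c := fun h => hpc ((Nat.dvd_add_right hpa).mp h)
  obtain ⟨k, hk⟩ := hpa
  have h1 : c % p = b % p := by
    rw [← habc, hk, Nat.add_comm, Nat.add_mul_mod_self_left]
  have h2 : (a + c) % p = c % p := by
    rw [hk, Nat.add_comm, Nat.add_mul_mod_self_left]
  unfold datum
  rw [Nat.factorization_eq_zero_of_not_dvd hpc, Nat.factorization_eq_zero_of_not_dvd hpb,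
    Nat.factorization_eq_zero_of_not_dvd hpac]
  simp only [pow_zero, Nat.div_one, h2, h1]

/-- **Knob move on `b`**: `(a, b, c) ↦ (c, b, b + c)` preserves every datum at the primes of `b`. [folklore] -/
theorem datum_knob_b {a b c p : ℕ} (habc : a + b = c) (hpb : p ∣ b) (hpa : ¬ p ∣ a) :
    datum c b (b + c) p = datum a b c p := by
  have hpc : ¬ p ∣ c := fun h => hpa ((Nat.dvd_add_left hpb).mp (habc ▸ h))
  have hpbc : ¬ p ∣ b + c := fun h => hpc ((Nat.dvd_add_right hpb).mp h)
  obtain ⟨k, hk⟩ := hpb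
  have h1 : c % p = a % p := by
    rw [← habc, hk, Nat.add_mul_mod_self_left]
  have h2 : (b + c) % p = c % p := by
    rw [hk, Nat.add_comm, Nat.add_mul_mod_self_left]
  unfold datum
  rw [Nat.factorization_eq_zero_of_not_dvd hpc, Nat.factorization_eq_zero_of_not_dvd hpa,
    Nat.factorization_eq_zero_of_not_dvd hpbc]
  simp only [pow_zero, Nat.div_one, h2, h1]

/-- **Same-sum shift**: two triples with the SAME third member `c` share the datum at a prime `p ∣ c` as
soon as their first members agree mod `p` — the only free move in position 3 (the sum).  Inside the
balance window it exists only when `c` has a large smooth part or a repeated prime (`a′ = a + i·M`,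
`p ∣ M`, `a′ < c`): position 3 is the bottleneck of every template (F7(ii)). [folklore] -/
theorem datum_shift_c {a b c a' b' p : ℕ} (habc : a + b = c) (habc' : a' + b' = c) (hpc : p ∣ c)
    (hpa : ¬ p ∣ a) (hmod : a' % p = a % p) : datum a' b' c p = datum a b c p := by
  have hpb : ¬ p ∣ b := fun h => hpa ((Nat.dvd_add_left h).mp (habc ▸ hpc))
  have hpa' : ¬ p ∣ a' := fun h => hpa (by
    have : a % p = 0 := by rw [← hmod]; exact Nat.mod_eq_zero_of_dvd h
    exact Nat.dvd_of_mod_eq_zero this)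
  have hpb' : ¬ p ∣ b' := fun h => hpa' ((Nat.dvd_add_left h).mp (habc' ▸ hpc))
  have h1 : b' % p = b % p := by
    have h : a' + b' ≡ a + b [MOD p] := by rw [habc, habc']
    exact Nat.ModEq.add_left_cancel hmod h
  unfold datum
  rw [Nat.factorization_eq_zero_of_not_dvd hpa, Nat.factorization_eq_zero_of_not_dvd hpb,
    Nat.factorization_eq_zero_of_not_dvd hpa', Nat.factorization_eq_zero_of_not_dvd hpb']
  simp only [pow_zero, Nat.div_one, hmod, h1]

end Moves

/-! ## 6. F7 — accounting laws every template obeys (why the obvious designs die)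

All elementary; recorded so that the next seat does not re-derive them.  Notation: `mass(T) = log(abc)`,
`val(d) = (2v − 6 − ε) log p`, gain `G = Σ_net val`, `‖F‖₁ = Σ |w_T|`.

(i) RATE LAW (LANDED, p134855: `Theorems/ReceptacleIdentity/Negative/StableSzpiroMatchedRateLaw.lean`,
in the line's own `SignedFamily` currency).  For a matched family
`G = Σ_d ∂F(d) val(d) ≤ 2 Σ_d ∂F(d) v_d log p_d = 2 Σ_T w_T mass(T)` (`∂F ≥ 0`;
`Σ_{d ∈ T} v_d log p_d = mass(T)` exactly; typed: `matched_sum_log_rad_nonneg`, `matched_linGain_le`).  So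
a certificate of ratio `C` has `Σ_T w_T mass(T) ≥ (C/2) ‖F‖₁`: positives must out-weigh negatives in
log-height by `C/2` per unit of norm, whence some `abc > exp(C/2)` (`height_of_matchedFreeLunch_ratio`)
and `r*(X) ≤ 2 log X³ = 6 log X`, i.e. `r*(X) = O(log X)` (`matched_linGain_le_height`).  Mass bookkeeping sharpens the constant: a
negative releases at most `(4+ε)·mass ≈ 12 log c`, each of its three members must be covered by positives'
generic members, a positive built around one powerful member supplies `≈ 2 log c` of coverable mass and
`≈ 2 log c` of gain, so `P ≈ 1.5 N` and `ratio ≲ 1.2 log c`.  The LP growth (F8: `≈ +0.70` per doubling of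
`X`, i.e. `≈ 1.0` per unit of `log X`) is therefore NEAR THE CEILING: the optimal certificates are not
wasteful, and no radically cheaper template exists — a template is a way of organising near-perfect
covering, not a trick that beats the count.

(ii) POSITION 3.  A member that is the SUM in one triple and a SUMMAND in another carries different
`(i,j,k)` patterns, so the knob chain `(a,b,c) → (a,c,a+c) → (a,a+c,2a+c) → …` shares only the `a`-data;
sums are shared only by the same-sum shift (`datum_shift_c`), i.e. among triples with the same `c` and
`a′ ≡ a (mod rad of the LARGE part of c)` — `⌊b / rad L_c⌋` partners, available exactly when `c` has a
substantial small-prime or repeated part (`c = 17², 2³·31, 2²·3·5·7, …`) — or prime by prime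
(`a′ = a + jp`, one covering triple per large prime of `c`).  At `X ≤ 800` the optimum uses the same-`c`
shift as often as the two knob moves (F8(c): 859 / 826 / 822 sharing pairs of kinds same-`c` / same-`b` /
same-`a` at `X = 400`, against 100 prime-level pairs): member-level sharing modulo the SMALL part of the
member is the workhorse, which is why small heights (large smooth parts) are favourable and why the
reservoir of tiny triples balancing the small-prime classes carries the largest weights.

(iii) S-UNIT CEILING.  If the gain members of the positives are `S`-units (`2^V`, `3^U`, `2^V 3^U`), a
negative `(x, y, z)` covered by them satisfies, prime by prime, `(x, y, z) ≡` an arrangement of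
`(2^{V_p}, 3^{U_p}, ·) (mod p)` with the extra `p²`-condition on the member divisible by `p`; with heights
confined to `[H, H^{O(1)}]` (by (iv)) only `O(log² H)` such positives exist, so a coverable negative must be
`(log H)^{O(1)}`-smooth in all three members — the `xyz`-smoothness regime (Lagarias–Soundararajan), not a
template.  Hence the powerful members of a template must come from a DENSE reservoir: perfect cubes
(`ε`-cheap: `val = −ε log` per prime at valuation `3`; density `H^{1/3}`) and fourth powers / `2^V`-parts
for the gain.  This is why `ε` small is the refuter's friend (TLR is `∀ ε`): at `ε → 0` cube-full private
data are free and only `v ≤ 2` data must cancel.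

(iv) NO UPWARD REGRESS.  Covering a datum at `p` of a negative by a positive at an astronomically larger
height (e.g. `2^{V′}` with `V′` a discrete logarithm mod `p`) never closes: the covering positive's generic
member imports `≍ log log` NEW large primes at the new height, each needing a negative there, and so on.
Closed designs live in a polynomially bounded height window; within it every datum class at `p ≤ H^{1/2}`
has many members (`m + kp²`), at `p > H^{1/2}` essentially one member but several triples
(`(a + jp, b − jp, c)`), so prime-level covering is always available combinatorially — the question is only
the `ℓ¹`-efficiency, which is what the LP measures.

(v) DEAD SUB-UNIVERSES (member-level slot counting).  Inside `{(x, 2^V − x, 2^V)}` (all `c = 2^V`): every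
level `V` must carry as many positive as negative edges (the `2`-class `(0,0,V)` of a negative must be
covered), and exact cancellation of ALL odd slots forces `#pos = #neg` level by level, so `G = 0`; if odd
prime-power classes (`3^U`, `5^W`, … at valuation `≥ 3`) are allowed to stay net-positive the count only
gives `P − N = E/2` (`E` = uncancelled powerful odd slots) and the family is alive on paper — it is then
the single-level arena of F9(4) — but numerically `U_V ⊇ {c = 2^V}` still has `r* = 0` at `V ≤ 12` (F8(b)).  Inside
`U_V = {triples ∋ 2^V}` with cube-containing positives `(2^V, m, w³)`, member-level cancellation of the
generic `m = w³ − 2^V` forces `2^{V+1} − w³` to be a cube, i.e. `w³ + u³ = 2^{V+1}` — no solutions.  Pell /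
Lucas divisibility families (`(1, d y_n², x_n²)`, `y_n ∣ y_{kn}`) share large primes across the family but
with unit residues off by the factor `k² (mod p)` (`y_{kn}/y_n ≡ ±k x_n^{k−1}`), and cyclotomic families
(`2^{km} − 1 = (2^m − 1)·Φ`, `Φ ≡ k`) by the factor `k`: algebraic divisibility never delivers EQUAL unit
residues, which is the arithmetic face of r2-1's "char-0 formal certificates are overdetermined".
Consequence: templates are prime-level covering designs (many triples per member), found so far only by
the LP; the honest programme is LP DISTILLATION at growing `X` with small primes freed (schema of §5),
`ε` small, and the covering graph read off (F8(c)), not a closed-form algebraic family.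
-/


/-! ## 7. F8 — LP evidence, cycle 2 (kit jobs j021186, j021202–j021204, j021236, j021254, j021284; script
`lp/freelunch_lp.py`, analysers `lp/analyze_cert.py`, `components.py`, `trace.py`, `analyze_dual.py`, all attached
as evidence on stmt-ABC-1813 in `lp-bundle.txt`; the compute-<id>.json summaries are attached by the daemon)

The LP: `r*(U) = max { Σ_T w_T s_T : ∂w ≥ 0 on constrained classes, ‖w‖₁ ≤ 1 }` over a finite universe
`U` of `κ`-balanced triples, `s_T = Σ_{p∣abc} (2v_p − 6 − ε) log p`, classes = the crux's exact data
`(p; i,j,k; r,s,z)`; `@P₀`: classes with `p ≤ P₀` unconstrained, a negative part there charged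
`ρ (v+1) log p` (`ρ = c₁′/c₁ := 3`) as the near-matched schema of §5 allows; `refund`: a positively weighted
triple is refunded its own positive excess (`FreeLunchBeyondSingletons`), isolating the gain manufactured by
cancellation.  Universes: ALL:X (all balanced triples, `c ≤ X`), ALLS:X~θ (members `X^θ`-smooth),
SMOOTH:X~P (all three members `P`-smooth: S-unit webs), POW2:V (`U_V` = triples containing `2^V`).
Interior point (HiGHS ipm) solves `X = 1131` (340 556 triples) in 432 s; the dual simplex needs 200 s at
`X = 200` already.

(a) REPLICATION AND GROWTH (`κ = 1/16`, `ε = 1`, ALL:X@13): `r* = 0.3813 / 1.0809 / 1.3357 / 1.7672 / 2.1723`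
at `X = 200 / 400 / 566 / 800 / 1131` (supports 797 / 2 938 / 4 500 / 6 730 / 9 475 triples); `X = 200`
replicates ideator 5 (j017861: 0.386, 799 triples, 26 net classes at `p ∈ {2,3,5}` — here 26 net classes,
identical); increments `0.70, 0.69, 0.84` per doubling: `r*(X) ≈ log X − 4.9`, LINEAR IN `log X` with slope
`≈ 1` (rate-law ceiling `6`, mass-count ceiling `≈ 1.2`, F7(i)).  `refund` changes nothing up to `X = 800`
(`1.0809`, `1.7672` identical): at `ε = 1` no singleton below `10³` has positive excess, the value is genuine
cancellation gain.  Freeing the primes `≤ 13` changes NOTHING (`r*` identical to 4 decimals at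
`X = 200, 400`).  `ε`-dial: `ε = 0.25` gives `1.367 / 2.142` at `X = 400 / 800` (slope `1.12` per `log X`);
cube members (`5³`, `7³`, `3³`) enter the positives exactly as F7(iii) predicts.  `X = 1600`:
`r* = 2.4906` (680 966 triples, support 12 834, ipm 2 681 s) — increment `0.72` for the last doubling; the law
`r*(X) ≈ 1.0·log X − 4.9` holds from `X = 200` to `X = 1600` with no curvature (refund at `1600`: job
j021284, pending at publication; its compute-<id>.json is attached by the daemon).
(b) UNIVERSES.  `U_V` is DEAD: `r* = 0` at `V = 10` (15 740 triples) and `V = 12` (62 958 triples) with small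
primes freed — F7(v) numerically.  Members-`X^{1/2}`-smooth at `X ≤ 800` (smoothness bound `≤ 28`): weak
(`0`, `0.635`).  But S-unit webs over the primes `≤ 47` are STRONG: SMOOTH:2000~50 `2.179` (33 190
triples, web of 6 890), SMOOTH:10000~50 `4.171` (90 368 triples, web of 13 406; refund `4.054` — the web is genuine),
SMOOTH:50000~50 `6.171` (199 374 triples, web of 20 267, ipm 868 s); over the primes `≤ 29`: SMOOTH:10000~30 `3.313` = the SINGLETON `625 + 2048 = 2673 = 3⁵·11` (`s = 3.31` at `ε = 1`!),
with refund `2.802` (a genuine web of 4 389 triples); SMOOTH:100000~30 `7.610` = the singleton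
`2¹⁰·7 + 5⁷ = 3⁸·13` (refund at `10⁵` pending in j021284; SMOOTH:200000~50 pending in j021236).  S-UNIT
WEB GROWTH LAW (primes `≤ 47`, `κ = 1/16`, `ε = 1`, web values): `2.18 / 4.05 / 6.17` at heights
`2·10³ / 10⁴ / 5·10⁴`, i.e. slope `≈ 1.2–1.3` per unit of log-height INSIDE A FIXED 15-PRIME ALPHABET, no
sign of saturation yet (saturation is forced eventually: finitely many `S`-unit triples).
`κ = 1/4`, `ε = 0.25`, `X = 800`: `1.887` = the singleton
`13² + 7³ = 2⁹`; nothing beyond singletons fires on the quarter cell up to `X = 800` (ideators: `0` at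
`ε = 1`, `X ≤ 400`); `X = 1600`: the quarter-cell LP is markedly harder for the interior point
(285 s at `X = 800` against 160 s for the larger `κ = 1/16` universe) and j021204 hit its 3 000 s limit
without a solution (389 122 triples); re-submitted with refund and a 12 000 s limit as j021657
(daemon-attached when done).
LESSON: every universe containing a famous high-quality triple is dominated by it unless refunded; the
refunded cancellation web is worth `≈ log(height) − 5` per unit norm at `κ = 1/16` in the full universe to
`1.6·10³` and MORE (`≈ 1.25 log(height) − 7.4`) in the `47`-smooth S-unit universe to `5·10⁴` — the
strongest numerical evidence so far that matched free lunches are unbounded — and nothing beyond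
singletons fires at `κ = 1/4` up to `X = 800`.
(c) STRUCTURE OF THE OPTIMUM (`X = 400 / 800`, `ε = 1`; `X = 800`, `ε = 0.25`).  One GIANT connected
component of the large-prime sharing graph (6 340 of 6 730 triples at `X = 800`; 5 705 of 6 135 at
`ε = 0.25`), the rest being 200+ isolated 13-smooth triples (the reservoir) and `≤ 6`-triple fragments;
large-prime classes cancel mostly ONE positive against ONE negative (1 464 of 1 973 classes at `X = 400`;
3 309 of 4 965 at `X = 800, ε = 0.25`); sharing pairs by kind at `X = 400`: same-`c` 859, same-`b` 826,
same-`a` 822, prime-level (`diff-*`) 100 — member-level sharing modulo the member's LARGE radical is the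
workhorse (knob moves and same-sum shifts, §5); positives carry the high powers (`2⁸`, `2⁹`, `3⁴`, `3⁵`,
`5⁴`, `7³`; weight share of `v₂ ≥ 6`: 28 % for positives, 3.5 % for negatives), are S-unit-rich
(`2⁸+33 = 17²`, `175+81 = 2⁸`, `64+17 = 3⁴`, `2⁸+87 = 7³`, `53+2⁵·11 = 3⁴·5`, `2⁶+5³ = 3³·7`) and sit
slightly LOWER than the negatives (weighted mean `log(abc)` 12.11 vs 13.12 at `X = 400`; the rate law is
met through `Σ w = +0.17`, more positive than negative weight); the largest weights sit on the tiny
reservoir triples `(1,2,3), (1,3,4), (1,4,5)` (`±0.01`), i.e. clearing the small-prime classes is the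
binding cost at these heights.  Explicit `±1` sub-clusters matched exactly at the large primes exist (§8)
but none is profitable alone.
(d) THE BEST TABLE (LP dual at `X = 800`, `ε = 1`, central ipm solution; `analyze_dual.py`): at valuation 1
the optimal one-sided table has mean `+0.63 log p` in positions 1–2 and `−0.24 log p` in position 3 (far
above the lower window `−5 log p`), spread `≈ 3.1 log p` across residues, and NO simple residue law:
variance explained by the unit residue alone 0.29, by the partner residue 0.11, by `unit/partner` or
`unit·partner (mod p)` 0.09, by `p` alone 0.01; no correlation with the archimedean size of the residues
(`|corr| ≤ 0.11`).  A would-be receptacle table at these heights is a generic function of (unit, partner),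
centred at zero — nothing character-like, nothing "canonical", consistent with Theorem T / the cycle-1
Galois-side no-go's.
-/

/-! ## 8. F9 — bottom line of cycle 2 for the planner and the lead (why the template is a DESIGN, not a formula)

Putting F7 and F8 together.  (1) Every LP optimum decomposes as: S-unit-RICH positives (two smooth
powerful members and one generic member: `2⁸+87 = 7³`, `53+2⁵·11 = 3⁴·5`, `2⁶+5³ = 3³·7`, …), generic or
smooth negatives, exact `±` cancellation of ALL large-prime data — 75–80 % of it member-level (same member,
partner congruent modulo the member's LARGE radical only: knob moves and same-sum shifts), the rest
prime-level — and a reservoir of small triples clearing the low-valuation SMALL-prime classes; the whole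
support is ONE connected web (largest component 94 % of the triples at `X = 800`, both at `ε = 1` and
`ε = 0.25`), and explicit `±1` sub-clusters matched exactly at the large primes exist inside it (e.g. the
six triples `(87,256,343), (256,87,343), (53,352,405), (352,53,405)` `+1`, `(87,53,140), (53,87,140)` `−1`:
large-prime boundary `+29₁+29₂−29₁−53₂−53₁−29₂+53₁+53₂ = 0`) but are NOT profitable alone — their
low-valuation small-prime data (`11, 5, 3` passengers, the smooth negative member `140`) cost more than the
powers `2⁸, 2⁵, 3⁴` earn; profit exists only after global clearing.  (2) Scaling such clusters to height
`H → ∞` (the only way to unbounded ratio, F7(i)) forbids smooth negative members (bounded-valuation smooth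
numbers are bounded; unbounded valuations are unbounded defects) and forces every generic member to be
cleared exactly; by the supply count of F7(iii) (pure S-units: `log² H` positives, hopeless; two 4-full
members: `H^{1/2}` positives, enough to clear classes at primes `p ≤ H^{1/6}` only) a scalable design needs
ALL members `H^{δ}`-friable and supply ≈ demand in every residue class `(p; v; unit mod p, partner mod p)`
for `p ≤ H^{δ}` — i.e. joint equidistribution of friable numbers with power constraints in residue classes
to moduli `p³ ≤ H^{1/2}`.  That is an ANALYTIC input of exactly the kind the sibling crux's lines already
isolate (`PinningHypothesis`, `MatchingHypothesis`, `…StubFriableCharSumsOfLindelof` under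
`Theorems/TameLocalReceptacle/`), not a closed-form family: the creative stub `stub_matchedFreeLunch` of line
`stable-szpiro-duality` is, on this evidence, a random-design existence statement whose proof needs the same
friable equidistribution, and r2-1's predicted honest end ("no template found") is the likely outcome of a
purely combinatorial hunt.  RECOMMENDATION (planner-level, not a verdict): treat the two programmes as one —
the LP/Farkas currency (this crux) supplies the certificate SHAPE and the kernel-checked landing schemas
(`notTameLocalReceptacle_of_stubs`, and the weaker `TameLocalReceptacle_false_of_nearMatchedFreeLunch`
landed here), the analytic line (stmt-ABC-14354) supplies existence; a lead cycle spent on closed-form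
templates (dilation pairs, fourth-power multipliers, Pell/cyclotomic families, `U_V`) is predicted dead by
F7(iii)/(v) and F8(b).  (3) What would CHANGE this assessment: an LP optimum at some `(κ, ε, X)` whose support
splits into many small components of individually positive near-matched ratio (none does up to `X = 800`:
every component other than the giant one is a single smooth triple or a `≤ 6`-triple fragment of
non-positive ratio), or the S-unit webs (`SMOOTH:X~50`, fixed 15-prime alphabet), whose refunded ratio DOES keep
growing through height `5·10⁴` (`2.18 → 4.05 → 6.17`, F8(b)).  That growth must saturate (finitely many
`S`-unit triples for fixed `S`), but it relocates the template question usefully: inside an S-unit web EVERY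
class is a small-prime class (`p ≤ 47`), there are no large primes to match, and a certificate is a signed
design on the finite set of `S`-unit solutions of `a + b = c` balancing `O(|S|³ · V²)` residue-valuation
classes — unboundedness of matched free lunches is then the statement `sup_S r*_S = ∞`, a question about
the COMBINATORICS OF S-UNIT EQUATIONS as `|S| → ∞` (how many solutions with high valuations exist per
residue class), for which the density input is Erdős–Stewart–Tijdeman-type LOWER bounds for the number of
`S`-unit solutions (exp(c (s/log s)^{1/2}) solutions for suitable `S` of size `s`; Konyagin–Soundararajan
improved the exponent) rather than friable equidistribution at moving heights.  This is the one direction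
the disprover would pursue in a further cycle: an explicit EST-type family of `S`-unit-rich triples
(products of many small primes to high powers, built from smooth-number pigeonholing) organised into a
matched design — the LP says the designs are there at every height it can see.
(4) THE CLEANEST ARENA, AND WHERE THE ANALYTIC INPUT ENTERS.  Fix one level `c₀ = 2^N` and the family
`F_N = {(a, 2^N − a, 2^N)}`: every partner residue is the constant `2^N mod p`, the only `2`-class is
`δ_N = (2; 0,0,N; 1,1,1)` with forced table value `≥ (2N − 6 − ε) log 2 ≈ 2 log c₀`, and a class is an
ATOM `(p, position, v, unit residue)`.  Duality inside `F_N`: (α) with generic (non-friable) members the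
table wins by private atoms at primes `> 2^{N/2}` (cycle-1 `knob`); (β) with `y`-friable members and
all-junk triples only, the junk-mass table `−λ v log p` is constant up to `λ log(1/4κ(1−κ))` on `F_N`, which
forces `‖w‖₁ ≳ 2.9 N log 2 · W` for any exactly junk-matched family of net weight `W`, i.e. ratio `< 1`
(the member-level death of (v) in dual form); (γ) with PARTIALLY POWERFUL positives (a fixed fraction
`1 − j` of the odd mass of `a·b` in valuations `≥ 3`) that obstruction disappears (the junk-mass table then
separates powerful from generic triples by `λ(1−j)·2N log 2`, forcing `λ → 0`), and the accounting gives
ratio `≈ 2(1−j)/(1+j) · log c₀ → ∞` PROVIDED the junk atoms `(p, pos, v ≤ 2, u)` of the positives can be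
cancelled exactly against negatives `(a′, 2^N − a′, 2^N)` with `a′ ≡ a (mod p^{v+1})`, both `a′` and
`2^N − a′` friable.  The existence of such an exact design with bounded `‖w‖₁/W` is a statement about
the joint distribution of `y`-friable solutions of `a + b = 2^N` in residue classes to moduli
`p^{v+1} ≤ y³` — the friable circle method with congruence conditions (de la Bretèche–Granville, Drappeau,
Harper), i.e. EXACTLY the input `MatchingFamilies`/`PinningFamilies` of the sibling crux's lines, plus an
exact-rounding (absorption) step that the weak-topology formulation of `MatchingFamilies` avoids.  Verdict
for the template hunt: the exact-template route is DOMINATED by the matching-in-law route; its only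
advantage is a kernel-checkable finite certificate per ratio, which decides nothing.
-/

end Summit.ABC.ABC.Cruxes.ReceptacleIdentity.Disproof
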